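import Summits.QuantumFields.YangMills.Theorems.LuscherReductionRunningReductionTreeGaugeHaar
import Summits.QuantumFields.YangMills.Theorems.LuscherReductionRunningReductionLatticeTopLower
import HarnessLib

/-!
# The comb-gauge box trial function (sub-stub C4-low₀ of the fixed-lattice programme COARSE(L₀) — route `LuscherReduction`, crux RED
# stmt-QuantumFields-19978 KT-door 3b′ / crux `TwistedTraceScaling` stmt-QuantumFields-20203 S-BASE; design note
# `pub/ym-fleet/ym-luscher-20007-p1/COARSE-DESIGN.md` §8 brick (v), the β-UNIFORM floor `λ₀ ≥ c_L · c_β^{|E|}`)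

Companion of `…TreeGauge` / `…TreeGaugeHaar`.  The β-uniform lower bound for the top zero-flux transfer value `λ₀(β, L)` uses, instead of the
constant trial function of `…LatticeTopLower` (which loses a polynomial factor: the ground state concentrates on a `β^{-1/2}`-tube around the
gauge orbit of the trivial connection), the indicator of that tube read in the COMB GAUGE:
* §1 `treeGauge_gaugeTransform`, ★ `treeFix_gaugeTransform` — the comb gauge is gauge covariant up to the residual GLOBAL rotation by `g 0`:
  `treeFix (U^g) = (treeFix U)^{g(0)}`; `frobNorm_conj_sub_one` — `‖hWh⁻¹ − 1‖_F = ‖W − 1‖_F`;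
* §2 near-identity bounds in the comb gauge: `‖lineProd − 1‖_F ≤ n·s`, `‖treeGauge V x − 1‖_F ≤ 3L·s` when the TREE links are within `s` of `1`,
  ★ `frobNorm_treeFix_sub_one_le` — `‖treeFix V e − 1‖_F ≤ 6L·s + t` when moreover ALL links are within `t` of `1`;
* §3 the off-tree box `offBox ρ = {V | ‖V_e − 1‖_F ≤ ρ off the tree}`, `Haar^{⊗E}(offBox ρ) = ballVol(ρ)^{offCount L}`;
* §4 ★ the trial function `combTrial ρ = 𝟙_{offBox ρ} ∘ treeFix`: values in `{0,1}`, measurable, GAUGE INVARIANT (§1 + conjugation invariance of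
  the box), `‖combTrial ρ‖² = ballVol(ρ)^{offCount L}` (unit Jacobian of the comb gauge, `integral_comp_treeFix_eq`), and on its support every
  comb-gauge link is within `ρ` of `1`.
The transfer form of `combTrial ρ` and the floor itself are the next files (`…WindowMass`, `…UniformFloor`).
HONEST FRAMING: lattice bookkeeping on a fixed lattice; femto rung R2b1; not a gap, not infinite volume, not Clay.
-/

set_option autoImplicit false

noncomputable section

open MeasureTheory Filter Topology Real
open scoped Matrix ComplexConjugate BigOperators Matrix.Norms.Frobenius
open Literature.MathematicalPhysics.QuantumFieldTheory
open Literature.MathematicalPhysics.QuantumLattice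

namespace Summit.QuantumFields.YangMills.Theorems.FemtoTransferGap

variable {L : ℕ} [NeZero L]

/-! ## §1 Gauge covariance of the comb gauge -/

/-- **The comb transporter is gauge covariant**: `treeGauge (U^g) x = g(0) · treeGauge U x · g(x)⁻¹` (telescoping along the comb path).
[cite: SeilerLNP1982, §2] -/
theorem treeGauge_gaugeTransform (g : Site 3 L → SU2) (U : GaugeConfig 3 L SU2) (x : Site 3 L) :
    treeGauge (gaugeTransform g U) x = g 0 * treeGauge U x * (g x)⁻¹ := by
  unfold treeGauge
  rw [lineProd_gaugeTransform, lineProd_gaugeTransform, lineProd_gaugeTransform, natCast_val_eq, natCast_val_eq, natCast_val_eq,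
    zero_add_single, base1_add_single, base2_add_single]
  group

/-- ★ **The comb gauge is gauge covariant up to a global rotation**: `treeFix (U^g) = (treeFix U)^{g(0)}` with the CONSTANT gauge
transformation `x ↦ g(0)`. [cite: SeilerLNP1982, §2] -/
theorem treeFix_gaugeTransform (g : Site 3 L → SU2) (U : GaugeConfig 3 L SU2) :
    treeFix (gaugeTransform g U) = gaugeTransform (fun _ => g 0) (treeFix U) := by
  funext e
  show treeGauge (gaugeTransform g U) e.1 * gaugeTransform g U e * (treeGauge (gaugeTransform g U) (e.1.shift e.2))⁻¹ =
    g 0 * (treeGauge U e.1 * U e * (treeGauge U (e.1.shift e.2))⁻¹) * (g 0)⁻¹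
  rw [treeGauge_gaugeTransform, treeGauge_gaugeTransform]
  simp only [gaugeTransform, mul_inv_rev, inv_inv]
  group

omit [NeZero L] in
/-- A constant gauge transformation conjugates every link. [folklore] -/
theorem gaugeTransform_const_apply (h : SU2) (V : GaugeConfig 3 L SU2) (e : Edge 3 L) :
    gaugeTransform (fun _ : Site 3 L => h) V e = h * V e * h⁻¹ := rfl

/-- `‖h W h⁻¹ − 1‖_F = ‖W − 1‖_F` (two-sided unitary invariance of the Frobenius norm). [cite: HornJohnson2013, Thm 2.2.2] -/
theorem frobNorm_conj_sub_one (h W : SU2) :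
    frobNorm (((h * W * h⁻¹ : SU2) : Matrix (Fin 2) (Fin 2) ℂ) - 1) = frobNorm ((W : Matrix (Fin 2) (Fin 2) ℂ) - 1) := by
  have h1 : (h : Matrix (Fin 2) (Fin 2) ℂ) * ((h⁻¹ : SU2) : Matrix (Fin 2) (Fin 2) ℂ) = 1 := by
    rw [← Submonoid.coe_mul, mul_inv_cancel]; rfl
  have e1 : ((h * W * h⁻¹ : SU2) : Matrix (Fin 2) (Fin 2) ℂ) - 1 =
      (h : Matrix (Fin 2) (Fin 2) ℂ) * (((W : Matrix (Fin 2) (Fin 2) ℂ) - 1) * ((h⁻¹ : SU2) : Matrix (Fin 2) (Fin 2) ℂ)) := by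
    rw [Matrix.sub_mul, Matrix.one_mul, Matrix.mul_sub, h1, Submonoid.coe_mul, Submonoid.coe_mul, Matrix.mul_assoc]
  rw [e1, frobNorm_unitary_mul (su2_mem_unitaryGroup h), frobNorm_mul_unitary _ (su2_mem_unitaryGroup h⁻¹)]

/-! ## §2 Near-identity bounds in the comb gauge -/

omit [NeZero L] in
/-- A partial line whose OWN links are within `s` of `1` is within `n·s` of `1` (the tree's `frobNorm_lineProd_sub_one_le` asks it of all
links). [folklore] -/
theorem frobNorm_lineProd_sub_one_le_of (V : GaugeConfig 3 L SU2) (x : Site 3 L) (k : Fin 3) {s : ℝ} :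
    ∀ n : ℕ, (∀ j : ℕ, j < n → frobNorm ((V (x + Pi.single k ((j : ℕ) : ZMod L), k) : Matrix (Fin 2) (Fin 2) ℂ) - 1) ≤ s) →
      frobNorm (((lineProd V x k n : SU2) : Matrix (Fin 2) (Fin 2) ℂ) - 1) ≤ n * s
  | 0, _ => by simp [frobNorm_zero]
  | n + 1, h => by
    rw [lineProd_succ]
    refine (frobNorm_mul_sub_one_le _ _).trans ?_
    have ih := frobNorm_lineProd_sub_one_le_of V x k n fun j hj => h j (Nat.lt_succ_of_lt hj)
    have hn := h n (Nat.lt_succ_self n)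
    push_cast
    linarith

/-- The comb transporter of a configuration whose TREE links are within `s` of `1` is within `3L·s` of `1`. [folklore] -/
theorem frobNorm_treeGauge_sub_one_le (V : GaugeConfig 3 L SU2) {s : ℝ} (hs : 0 ≤ s)
    (hV : ∀ e : Edge 3 L, treeEdge e = true → frobNorm ((V e : Matrix (Fin 2) (Fin 2) ℂ) - 1) ≤ s) (x : Site 3 L) :
    frobNorm (((treeGauge V x : SU2) : Matrix (Fin 2) (Fin 2) ℂ) - 1) ≤ 3 * L * s := by
  unfold treeGauge
  have hb1 : ∀ j : Fin 3, j ≠ 0 → base1 x j = 0 := fun j hj => by rw [base1_apply, if_neg hj]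
  have h0 := frobNorm_lineProd_sub_one_le_of V 0 0 (x 0).val fun j hj => hV _ (treeEdge_zero hj)
  have h1 := frobNorm_lineProd_sub_one_le_of V (base1 x) 1 (x 1).val fun j hj =>
    hV _ (treeEdge_one (hb1 1 (by decide)) (hb1 2 (by decide)) hj)
  have h2 := frobNorm_lineProd_sub_one_le_of V (base2 x) 2 (x 2).val fun j hj => hV _ (treeEdge_two (by rw [base2_apply, if_pos rfl]) hj)
  have hv : ∀ a : ZMod L, ((a.val : ℕ) : ℝ) ≤ L := fun a => by exact_mod_cast (ZMod.val_lt a).le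
  have h01 := frobNorm_mul_sub_one_le (lineProd V 0 0 (x 0).val) (lineProd V (base1 x) 1 (x 1).val)
  have h012 := frobNorm_mul_sub_one_le (lineProd V 0 0 (x 0).val * lineProd V (base1 x) 1 (x 1).val) (lineProd V (base2 x) 2 (x 2).val)
  have hx0 := mul_le_mul_of_nonneg_right (hv (x 0)) hs
  have hx1 := mul_le_mul_of_nonneg_right (hv (x 1)) hs
  have hx2 := mul_le_mul_of_nonneg_right (hv (x 2)) hs
  linarith

/-- ★ **Comb-gauge links stay near `1`**: if the tree links of `V` are within `s` of `1` and all links within `t` of `1`, then every link of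
`treeFix V` is within `6L·s + t` of `1`. [folklore] -/
theorem frobNorm_treeFix_sub_one_le (V : GaugeConfig 3 L SU2) {s t : ℝ} (hs : 0 ≤ s)
    (hVt : ∀ e : Edge 3 L, treeEdge e = true → frobNorm ((V e : Matrix (Fin 2) (Fin 2) ℂ) - 1) ≤ s)
    (hV : ∀ e : Edge 3 L, frobNorm ((V e : Matrix (Fin 2) (Fin 2) ℂ) - 1) ≤ t) (e : Edge 3 L) :
    frobNorm ((treeFix V e : Matrix (Fin 2) (Fin 2) ℂ) - 1) ≤ 6 * L * s + t := by
  have h1 := frobNorm_treeGauge_sub_one_le V hs hVt e.1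
  have h2 : frobNorm ((((treeGauge V (e.1.shift e.2))⁻¹ : SU2) : Matrix (Fin 2) (Fin 2) ℂ) - 1) ≤ 3 * L * s := by
    rw [frobNorm_inv_sub_one]; exact frobNorm_treeGauge_sub_one_le V hs hVt _
  have h3 := frobNorm_mul_sub_one_le (treeGauge V e.1) (V e)
  have h4 := frobNorm_mul_sub_one_le (treeGauge V e.1 * V e) (treeGauge V (e.1.shift e.2))⁻¹
  have h5 : treeFix V e = treeGauge V e.1 * V e * (treeGauge V (e.1.shift e.2))⁻¹ := rfl
  rw [h5]
  linarith [hV e]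

/-! ## §3 The off-tree box -/

/-- **Off-tree box** `offBox ρ = {V | ‖V_e − 1‖_F ≤ ρ for every non-tree link e}` (no condition on the `L³ − 1` tree links). [folklore] -/
def offBox (ρ : ℝ) : Set (GaugeConfig 3 L SU2) :=
  {V | ∀ e : Edge 3 L, ¬ treeEdge e = true → frobNorm ((V e : Matrix (Fin 2) (Fin 2) ℂ) - 1) ≤ ρ}

variable (L) in
/-- The number of non-tree links (`= 2L³ + 1`; only its finiteness is used). [folklore] -/
def offCount : ℕ := (Finset.univ.filter fun e : Edge 3 L => ¬ treeEdge e = true).card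

omit [NeZero L] in
/-- The off-tree box is a product set. [folklore] -/
theorem offBox_eq_pi (ρ : ℝ) : offBox (L := L) ρ = Set.pi Set.univ fun e : Edge 3 L =>
    if treeEdge e = true then Set.univ else {W : SU2 | frobNorm ((W : Matrix (Fin 2) (Fin 2) ℂ) - 1) ≤ ρ} := by
  ext V
  simp only [offBox, Set.mem_setOf_eq, Set.mem_pi, Set.mem_univ, true_implies]
  refine forall_congr' fun e => ?_
  by_cases h : treeEdge e = true
  · simp [h]
  · simp [h]

/-- The off-tree box is measurable. [folklore] -/
theorem measurableSet_offBox (ρ : ℝ) : MeasurableSet (offBox (L := L) ρ) := by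
  rw [offBox_eq_pi]
  refine MeasurableSet.univ_pi fun e => ?_
  split_ifs
  · exact MeasurableSet.univ
  · exact measurableSet_frobBall_one ρ

/-- **`Haar^{⊗E}(offBox ρ) = ballVol(ρ)^{offCount L}`.** [folklore] -/
theorem configMeasure_real_offBox (ρ : ℝ) : (configMeasure SU2 L).real (offBox ρ) = ballVol ρ ^ offCount L := by
  rw [offBox_eq_pi, Measure.real, configMeasure, Measure.pi_pi, ENNReal.toReal_prod]
  have h : ∀ e : Edge 3 L, ((haarProbability SU2) (if treeEdge e = true then Set.univ else
      {W : SU2 | frobNorm ((W : Matrix (Fin 2) (Fin 2) ℂ) - 1) ≤ ρ})).toReal = if treeEdge e = true then 1 else ballVol ρ := by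
    intro e
    split_ifs
    · rw [measure_univ, ENNReal.toReal_one]
    · rfl
  rw [Finset.prod_congr rfl fun e _ => h e, Finset.prod_ite, Finset.prod_const_one, one_mul, Finset.prod_const]
  rfl

omit [NeZero L] in
/-- The box is monotone in the radius. [folklore] -/
theorem offBox_mono {ρ ρ' : ℝ} (h : ρ ≤ ρ') : offBox (L := L) ρ ⊆ offBox ρ' :=
  fun _ hV e he => (hV e he).trans h

omit [NeZero L] in
/-- Membership is invariant under a constant gauge transformation (conjugation of every link). [folklore] -/
theorem gaugeTransform_const_mem_offBox_iff (h : SU2) (V : GaugeConfig 3 L SU2) (ρ : ℝ) :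
    gaugeTransform (fun _ : Site 3 L => h) V ∈ offBox ρ ↔ V ∈ offBox ρ := by
  simp only [offBox, Set.mem_setOf_eq]
  refine forall_congr' fun e => imp_congr_right fun _ => ?_
  rw [gaugeTransform_const_apply, frobNorm_conj_sub_one]

omit [NeZero L] in
/-- `killTree` does not touch non-tree links. [folklore] -/
theorem killTree_apply_of_not_tree (U : GaugeConfig 3 L SU2) {e : Edge 3 L} (he : ¬ treeEdge e = true) : killTree U e = U e := by
  unfold killTree
  rw [eq_false_of_ne_true he]
  rfl

omit [NeZero L] in
/-- Hence `killTree U ∈ offBox ρ ↔ U ∈ offBox ρ`. [folklore] -/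
theorem killTree_mem_offBox_iff (U : GaugeConfig 3 L SU2) (ρ : ℝ) : killTree U ∈ offBox ρ ↔ U ∈ offBox ρ := by
  simp only [offBox, Set.mem_setOf_eq]
  refine forall_congr' fun e => ?_
  refine imp_congr_right fun he => ?_
  rw [killTree_apply_of_not_tree U he]

/-- A comb-gauge configuration (tree links `= 1`) lies in the box iff ALL its links are within `ρ` of `1` (`ρ ≥ 0`). [folklore] -/
theorem treeFix_mem_offBox_iff {ρ : ℝ} (hρ : 0 ≤ ρ) (U : GaugeConfig 3 L SU2) :
    treeFix U ∈ offBox ρ ↔ ∀ e : Edge 3 L, frobNorm ((treeFix U e : Matrix (Fin 2) (Fin 2) ℂ) - 1) ≤ ρ := by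
  refine ⟨fun h e => ?_, fun h e _ => h e⟩
  by_cases he : treeEdge e = true
  · rw [treeFix_eq_one_of_treeEdge U he]
    simpa [frobNorm_zero] using hρ
  · exact h e he

/-! ## §4 The comb-gauge box trial function -/

/-- **Comb-gauge box trial function** `combTrial ρ U = 𝟙[treeFix U ∈ offBox ρ]`: the indicator of "in the comb gauge every link is within `ρ`
of `1`" — a gauge-invariant neighbourhood of the gauge orbit of the trivial connection. [cite: Luscher1983, §2] -/
def combTrial (ρ : ℝ) (U : GaugeConfig 3 L SU2) : ℝ := (offBox ρ).indicator (fun _ => (1 : ℝ)) (treeFix U)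

omit [NeZero L] in
/-- Value `1` on the support. [folklore] -/
theorem combTrial_of_mem {ρ : ℝ} {U : GaugeConfig 3 L SU2} (h : treeFix U ∈ offBox ρ) : combTrial ρ U = 1 := by
  unfold combTrial; rw [Set.indicator_of_mem h]

omit [NeZero L] in
/-- Value `0` off the support. [folklore] -/
theorem combTrial_of_not_mem {ρ : ℝ} {U : GaugeConfig 3 L SU2} (h : treeFix U ∉ offBox ρ) : combTrial ρ U = 0 := by
  unfold combTrial; rw [Set.indicator_of_notMem h]

omit [NeZero L] in
/-- `0 ≤ combTrial ρ U`. [folklore] -/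
theorem combTrial_nonneg (ρ : ℝ) (U : GaugeConfig 3 L SU2) : 0 ≤ combTrial ρ U := by
  unfold combTrial
  exact Set.indicator_nonneg (fun _ _ => zero_le_one) _

omit [NeZero L] in
/-- `combTrial ρ U ≤ 1`. [folklore] -/
theorem combTrial_le_one (ρ : ℝ) (U : GaugeConfig 3 L SU2) : combTrial ρ U ≤ 1 := by
  unfold combTrial
  exact Set.indicator_le_self' (fun _ _ => zero_le_one) _

omit [NeZero L] in
/-- `|combTrial ρ U| ≤ 1`. [folklore] -/
theorem abs_combTrial_le (ρ : ℝ) (U : GaugeConfig 3 L SU2) : |combTrial ρ U| ≤ 1 := by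
  rw [abs_of_nonneg (combTrial_nonneg ρ U)]; exact combTrial_le_one ρ U

omit [NeZero L] in
/-- `combTrial ρ` is an indicator: `combTrial² = combTrial`. [folklore] -/
theorem combTrial_mul_self (ρ : ℝ) (U : GaugeConfig 3 L SU2) : combTrial ρ U * combTrial ρ U = combTrial ρ U := by
  by_cases h : treeFix U ∈ offBox ρ
  · rw [combTrial_of_mem h, mul_one]
  · rw [combTrial_of_not_mem h, mul_zero]

/-- `combTrial ρ` is measurable. [folklore] -/
theorem measurable_combTrial (ρ : ℝ) : Measurable (combTrial (L := L) ρ) :=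
  (measurable_const.indicator (measurableSet_offBox ρ)).comp measurable_treeFix

/-- ★ **`combTrial ρ` is gauge invariant** (`treeFix (U^g) = (treeFix U)^{g(0)}` and the box is conjugation invariant). [folklore] -/
theorem combTrial_gaugeTransform (ρ : ℝ) (g : Site 3 L → SU2) (U : GaugeConfig 3 L SU2) :
    combTrial ρ (gaugeTransform g U) = combTrial ρ U := by
  have hiff : treeFix (gaugeTransform g U) ∈ offBox ρ ↔ treeFix U ∈ offBox ρ := by
    rw [treeFix_gaugeTransform, gaugeTransform_const_mem_offBox_iff]
  by_cases h : treeFix U ∈ offBox ρ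
  · rw [combTrial_of_mem h, combTrial_of_mem (hiff.mpr h)]
  · rw [combTrial_of_not_mem h, combTrial_of_not_mem fun h' => h (hiff.mp h')]

/-- The comb-gauge representative is a fixed point of the trial function's argument: `combTrial ρ (treeFix U) = combTrial ρ U`. [folklore] -/
theorem combTrial_treeFix (ρ : ℝ) (U : GaugeConfig 3 L SU2) : combTrial ρ (treeFix U) = combTrial ρ U :=
  combTrial_gaugeTransform ρ (treeGauge U) U

omit [NeZero L] in
/-- Monotonicity in the radius. [folklore] -/
theorem combTrial_mono {ρ ρ' : ℝ} (h : ρ ≤ ρ') (U : GaugeConfig 3 L SU2) : combTrial ρ U ≤ combTrial ρ' U := by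
  by_cases hU : treeFix U ∈ offBox ρ
  · rw [combTrial_of_mem hU, combTrial_of_mem (offBox_mono h hU)]
  · rw [combTrial_of_not_mem hU]; exact combTrial_nonneg ρ' U

/-- ★ **`∫ combTrial ρ = ballVol(ρ)^{offCount L}`** (unit Jacobian of the comb gauge: `∫ F∘treeFix = ∫ F∘killTree`, and `killTree U ∈ offBox ρ ↔
U ∈ offBox ρ`). [cite: SeilerLNP1982, §2] -/
theorem integral_combTrial (ρ : ℝ) : ∫ U, combTrial ρ U ∂configMeasure SU2 L = ballVol ρ ^ offCount L := by
  unfold combTrial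
  rw [integral_comp_treeFix_eq (measurable_const.indicator (measurableSet_offBox ρ))]
  have hk : ∀ U : GaugeConfig 3 L SU2, (offBox ρ).indicator (fun _ => (1 : ℝ)) (killTree U) = (offBox ρ).indicator (fun _ => (1 : ℝ)) U := by
    intro U
    by_cases h : U ∈ offBox ρ
    · rw [Set.indicator_of_mem h, Set.indicator_of_mem ((killTree_mem_offBox_iff U ρ).mpr h)]
    · rw [Set.indicator_of_notMem h, Set.indicator_of_notMem fun h' => h ((killTree_mem_offBox_iff U ρ).mp h')]
  simp_rw [hk]
  rw [integral_indicator_const _ (measurableSet_offBox ρ), smul_eq_mul, mul_one, configMeasure_real_offBox]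

/-- ★ **`‖combTrial ρ‖² = ballVol(ρ)^{offCount L}`.** [folklore] -/
theorem l2_combTrial (ρ : ℝ) : l2 (combTrial (L := L) ρ) (combTrial ρ) = ballVol ρ ^ offCount L := by
  unfold l2
  simp_rw [combTrial_mul_self]
  exact integral_combTrial ρ

/-- ★ On the support of `combTrial ρ` every comb-gauge link is within `ρ` of `1` (`ρ ≥ 0`). [folklore] -/
theorem frobNorm_treeFix_le_of_combTrial_ne_zero {ρ : ℝ} (hρ : 0 ≤ ρ) {U : GaugeConfig 3 L SU2} (h : combTrial ρ U ≠ 0) (e : Edge 3 L) :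
    frobNorm ((treeFix U e : Matrix (Fin 2) (Fin 2) ℂ) - 1) ≤ ρ := by
  by_cases hU : treeFix U ∈ offBox ρ
  · exact (treeFix_mem_offBox_iff hρ U).mp hU e
  · exact absurd (combTrial_of_not_mem hU) h

end Summit.QuantumFields.YangMills.Theorems.FemtoTransferGap

end
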